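import Mathlib
import Summits.Ventures.FusionMHD.Models.CerfonFreidbergIterLikeQHalfShearDefs
import HarnessLib

/-!
# Ventures/FusionMHD — Models/CerfonFreidbergIterLikeQHalfShearPanels6.lean: KERNEL CHECK of the shear-register certificates of panels 10, 11 (of 32)
# at `ψ_N = 1/2` of THE Cerfon–Freidberg ITER-like instance

HONEST FRAMING (LADDER-GRIDFUSION three columns; CF rung; successor step of «q′(ψ_N = 1/2) on the CF rung», F2-SCOPING v1.6 §10(c)).  One `decide +kernel`
(≈ 80 s): for each listed panel the obligation `CFIterLike.QHalfShear.ShearCert.ok` (`Models/CerfonFreidbergIterLikeQHalfShearDefs.lean`) — the Taylor-model run of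
`progQ = CFIterLike.QHalf.progA ++ blockQ` over ★ #117's parameter box is ACCEPTED and the kernel's panel-integral enclosure of the shear kernel `K·p` along the
approximant lies inside the claimed integers (read off a compiled `#eval` of the same functions, slack one unit of `2⁻⁶⁰`; float truth inside every panel).
MODELLED: analytic Cerfon–Freidberg family; nothing about a device or stability.  No `native_decide`.  Typer/prover: gridfusion-model-5 (g8), 2026-08-27.
Citations: Freidberg 2014 §6.3.5 (6.35) [Freidberg2014]; Mahboubi–Melquiond–Sibut-Pinote 2016 §3.2 Lemma 3 [MahboubiMelquiondSibutpinote2016].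
-/

namespace Summit.Ventures.FusionMHD.Models.CFIterLike.QHalfShear

/-- Shear-register certificate data of panels 10, 11. [instance data] -/
def shearCert6 : List ShearCert := [
  { j := 10, cand := [215147609067944280064, 1215538395975900987392, 6264991461932398542848, 26121894495012161323008, 96681701038281453469696, 307074175184206374633472, 806835865355263426953216, 1481626525518381728137216, 282514889778500196106240, -27416140274102702765506560, -1495418434339976286018994176, 11538535831386091640051466240, 1898889991097974937169136975872],
    deg := 10, elog2 := 43, plo := -1611247317139346014, phi := -1611247121106924955 },
  { j := 11, cand := [260150664824439832576, 1697049283206480920576, 9386567301462365306880, 41745757956655443607552, 157963928308492386959360, 485420680439503995797504, 1054567710941339864530944, 278672913860783484436480, -12749645725799753860513792, -94453804902512207723495424, -454808141014499099292991488, 8055424399970909795188211712, 220231231731989701964777652224],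
    deg := 10, elog2 := 43, plo := -1706894218355295266, phi := -1706894031086070665 }]

/-- **KERNEL CHECK** of the shear register on panels 10, 11. -/
theorem shearCert6_ok : CFIterLike.QHalfShear.shearCert6.all ShearCert.ok = true := by
  decide +kernel

end Summit.Ventures.FusionMHD.Models.CFIterLike.QHalfShear
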